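import Summits.CriticalPhenomena.PercolationContinuityZ3.Theorems.Transplant.SkelPhiEquilibrium
import HarnessLib

/-!
# N2 (the frames-only node `SamePDropOfSkeletonFrm₁`), LEVEL 0‴, file (L0‴-1): the ORIENTED EQUILIBRIUM — `Skelφ.EquilibriumAtWQ` (zone clearance of all eight
# pieces; links to the FOUR pieces of a preferred vertical side `σ₀` and a preferred slanted side `σ₁`) and `Skelφ.Eq.exists_equilibriumWQ` = Martineau–Tassion's
# Lemma 3.5 WITHOUT the central inversion (no `ρ`, no seed invariance)

The two 'by symmetry' lines of MT17 (p. 10 (21): `L(a₀,b₀)` vs `L(−a₀,−b₀)`; p. 11 (26): the two slanted sides) are square-root tricks; without symmetry the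
either/or form `ge_or_ge_of_union` (SkelPhiEquilibrium §3) gives the SAME exponents for ONE of the two sides — the preferred side is an output.  Everything else is
the text of `exists_equilibriumW` (SkelPhiEquilibrium :181) with the hard-coded side `1` replaced by `σ₀`/`σ₁` (heights on the side `σ` are measured by `σβ`, so the
re-centring `h := u` serves both sides); §1 gives the side-generic twins of the re-centring geometry.  Design: HOME/N2-SCOPE.md §3, §10 (R-5) (the signs are FROZEN data at
the reference density), hp-8 N2-SCOPE-F (V2).
builds on p205010 (kernel theorem, internal audit signed; external expert review pending) — nothing here uses p205010; NOTHING is claimed about the open node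
`SamePDropOfSkeletonFrm₁` (nor about N1, which is closed: p329520).  Lane `prim-bschramm`, seat `prim-bschramm-p3` (gen 13; N2 design owner); helper file
(`--supports stmt-CriticalPhenomena-4575 --as helper`).
[cite: MartineauTassion2017, §3.2 Lemma 3.5 (pp. 9–11), Lemma 3.2 (max form), Lemma 3.3] [cite: GrimmettPercolation1999, §11 (11.14)] [cite: KozmaNitzan2024, §4 p. 20 ((22)–(23))]
-/

noncomputable section

namespace Summit.CriticalPhenomena.PercolationContinuityZ3.Theorems.Transplant

namespace Skelφ

open MeasureTheory ProbabilityTheory Filter Topology Literature.Probability.Percolation Literature.Probability.LatticeModels SimpleGraph KNLevels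
open scoped Classical

variable {V : Type} (G : SimpleGraph V) (φ : V → Site 2)

/-- **Oriented equilibrium at width `n`** (frames-only LEVEL 0‴): the sentence of `EquilibriumAtW` with the universally quantified side sign replaced by a
PREFERRED vertical side `σ₀` (two halves `τ = ±1`) and a PREFERRED slanted side `σ₁` (two pieces `τ = ±1` split at `v`) — four linked pieces, a quadrant of exits.
[cite: MartineauTassion2017, §3.2 Lemma 3.5] [this work] -/
def EquilibriumAtWQ [G.LocallyFinite] (p : unitInterval) (t : V) (SEED : Finset V) (M : ℕ) (R : ℕ → ℕ) (ε : ℝ) (n : ℕ) : Prop :=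
  ∃ (σ₀ σ₁ h : ℤ) (ℓ : ℕ) (v : ℤ), (σ₀ = 1 ∨ σ₀ = -1) ∧ (σ₁ = 1 ∨ σ₁ = -1) ∧ M < n ∧ M < ℓ ∧ |v| ≤ n ∧
    (M + 1 : ℤ) * (n + h.natAbs : ℕ) ≤ (n : ℤ) * (ℓ + 1 : ℕ) ∧
    (∀ σ τ : ℤ, (σ = 1 ∨ σ = -1) → (τ = 1 ∨ τ = -1) →
      Disjoint (↑(pgSideHalfW G φ t n h ℓ (R (pgScale n h (3 * ℓ))) σ τ) : Set V) (cyl φ t M) ∧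
      Disjoint (↑(pgTopPieceW G φ t n h ℓ (R (pgScale n h (3 * ℓ))) σ τ v) : Set V) (cyl φ t M)) ∧
    ∀ τ : ℤ, (τ = 1 ∨ τ = -1) →
      1 - ε ≤ (bondPercolation G p).real
        (linkIn (pgramPrism G φ t n h (3 * ℓ) (R (pgScale n h (3 * ℓ)))) SEED (pgSideHalfW G φ t n h ℓ (R (pgScale n h (3 * ℓ))) σ₀ τ)) ∧
      1 - ε ≤ (bondPercolation G p).real
        (linkIn (pgramPrism G φ t n h (3 * ℓ) (R (pgScale n h (3 * ℓ)))) SEED (pgTopPieceW G φ t n h ℓ (R (pgScale n h (3 * ℓ))) σ₁ τ v))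

variable {G φ}

/-- The symmetric equilibrium implies the oriented one (take `σ₀ = σ₁ = 1`). [folklore] -/
theorem EquilibriumAtW.toWQ [G.LocallyFinite] {p : unitInterval} {t : V} {SEED : Finset V} {M : ℕ} {R : ℕ → ℕ} {ε : ℝ} {n : ℕ}
    (hE : EquilibriumAtW G φ p t SEED M R ε n) : EquilibriumAtWQ G φ p t SEED M R ε n := by
  obtain ⟨h, ℓ, v, h1, h2, h3, h4, h5⟩ := hE
  exact ⟨1, 1, h, ℓ, v, Or.inl rfl, Or.inl rfl, h1, h2, h3, h4, fun σ τ hσ hτ => ⟨(h5 σ τ hσ hτ).1, (h5 σ τ hσ hτ).2.1⟩,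
    fun τ hτ => ⟨(h5 1 τ (Or.inl rfl) hτ).2.2.1, (h5 1 τ (Or.inl rfl) hτ).2.2.2⟩⟩

namespace Eq

variable {t : V}

/-! ## §1 Side-generic twins of the re-centring geometry -/

/-- The upper piece `[u, y]` (heights `σβ`) of the side `σ` of `C(n,h₀,ℓ₀)` lies in the side half `(σ, σ)` of `C(n,u,ℓ)` once `y − u ≤ ℓ`.
[cite: MartineauTassion2017, §3.2 (23)] -/
theorem sideSeg_subset_half_up' {n : ℕ} {h₀ : ℤ} {ℓ₀ ℓ : ℕ} {σ u y : ℤ} (hσ : σ = 1 ∨ σ = -1) (hyu : y - u ≤ ℓ) {w : V}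
    (hw : w ∈ sideSeg φ t n h₀ ℓ₀ σ u y) :
    w ∈ pgramCyl φ t n u ℓ ∧ relCoord φ t 0 w = σ * n ∧ 0 ≤ σ * shearCoord φ t n u w := by
  rw [mem_sideSeg] at hw
  obtain ⟨hC, hα, hx, hy⟩ := hw
  rw [mem_pgramCyl] at hC ⊢
  simp only [relCoord_apply, shearCoord_apply] at hC hα hx hy ⊢
  have hn0 : (0 : ℤ) ≤ n := by positivity
  rcases hσ with rfl | rfl
  · simp only [one_mul] at hα hx hy ⊢
    have e : (n : ℤ) * (φ w 1 - φ t 1) - u * (φ w 0 - φ t 0) = n * ((φ w 1 - φ t 1) - u) := by rw [hα]; ring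
    refine ⟨⟨hC.1, ?_⟩, hα, ?_⟩
    · rw [e, abs_mul, Nat.abs_cast]; exact mul_le_mul_of_nonneg_left (abs_le.2 ⟨by linarith, by linarith⟩) hn0
    · rw [e]; exact mul_nonneg hn0 (by linarith)
  · simp only [neg_mul, one_mul, neg_nonneg] at hα hx hy ⊢
    have e : (n : ℤ) * (φ w 1 - φ t 1) - u * (φ w 0 - φ t 0) = -(n * (-(φ w 1 - φ t 1) - u)) := by rw [hα]; ring
    refine ⟨⟨hC.1, ?_⟩, hα, ?_⟩
    · rw [e, abs_neg, abs_mul, Nat.abs_cast]; exact mul_le_mul_of_nonneg_left (abs_le.2 ⟨by linarith, by linarith⟩) hn0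
    · rw [e, neg_nonpos]
      exact mul_nonneg hn0 (by linarith)

/-- The lower piece `[x, u]` of the side `σ` lies in the side half `(σ, −σ)` of `C(n,u,ℓ)` once `u − x ≤ ℓ`. [cite: MartineauTassion2017, §3.2 (22)] -/
theorem sideSeg_subset_half_down' {n : ℕ} {h₀ : ℤ} {ℓ₀ ℓ : ℕ} {σ x u : ℤ} (hσ : σ = 1 ∨ σ = -1) (hux : u - x ≤ ℓ) {w : V}
    (hw : w ∈ sideSeg φ t n h₀ ℓ₀ σ x u) :
    w ∈ pgramCyl φ t n u ℓ ∧ relCoord φ t 0 w = σ * n ∧ 0 ≤ -σ * shearCoord φ t n u w := by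
  rw [mem_sideSeg] at hw
  obtain ⟨hC, hα, hx, hy⟩ := hw
  rw [mem_pgramCyl] at hC ⊢
  simp only [relCoord_apply, shearCoord_apply] at hC hα hx hy ⊢
  have hn0 : (0 : ℤ) ≤ n := by positivity
  rcases hσ with rfl | rfl
  · simp only [one_mul, neg_mul, neg_nonneg] at hα hx hy ⊢
    have e : (n : ℤ) * (φ w 1 - φ t 1) - u * (φ w 0 - φ t 0) = n * ((φ w 1 - φ t 1) - u) := by rw [hα]; ring
    refine ⟨⟨hC.1, ?_⟩, hα, ?_⟩
    · rw [e, abs_mul, Nat.abs_cast]; exact mul_le_mul_of_nonneg_left (abs_le.2 ⟨by linarith, by linarith⟩) hn0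
    · rw [e]; exact mul_nonpos_of_nonneg_of_nonpos hn0 (by linarith)
  · simp only [neg_mul, one_mul, neg_neg] at hα hx hy ⊢
    have e : (n : ℤ) * (φ w 1 - φ t 1) - u * (φ w 0 - φ t 0) = n * ((φ w 1 - φ t 1) + u) := by rw [hα]; ring
    refine ⟨⟨hC.1, ?_⟩, hα, ?_⟩
    · rw [e, abs_mul, Nat.abs_cast]; exact mul_le_mul_of_nonneg_left (abs_le.2 ⟨by linarith, by linarith⟩) hn0
    · rw [e]; exact mul_nonneg hn0 (by linarith)

/-- The top segments of the slanted side `σ` lie in the top pieces `(σ, τ, v)`. [folklore] -/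
theorem topSeg_subset_piece' {n : ℕ} {u : ℤ} {ℓ : ℕ} {σ τ v x y : ℤ} (hτ : (τ = 1 ∧ x = v ∧ y = n) ∨ (τ = -1 ∧ x = -(n : ℤ) ∧ y = v)) {w : V}
    (hw : w ∈ topSeg φ t n u ℓ σ x y) :
    w ∈ pgramCyl φ t n u ℓ ∧ (n : ℤ) * ℓ - (n + u.natAbs : ℕ) < σ * shearCoord φ t n u w ∧ 0 ≤ τ * (σ * relCoord φ t 0 w - v) := by
  rw [mem_topSeg] at hw
  obtain ⟨hC, hlay, hx, hy⟩ := hw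
  refine ⟨hC, hlay, ?_⟩
  rcases hτ with ⟨rfl, rfl, rfl⟩ | ⟨rfl, rfl, rfl⟩
  · linarith
  · linarith

/-! ## §2 The oriented equilibrium lemma (MT17 L3.5 without `A = −A`) -/

/-- **Martineau–Tassion's Lemma 3.5 for a FRAMES-ONLY skeleton** (no central inversion): hypotheses as `exists_equilibriumW` minus `ρ`, `hρt`, `hρφ`, `hSρ`.
Conclusion: `EquilibriumAtWQ … M R (ε + ε₀) n` for all large `n` — a preferred vertical side `σ₀` and a preferred slanted side `σ₁` (functions of the law),
each split into two pieces linked to the seed with probability `≥ 1 − ε − ε₀`.  Proof = the landed proof with the two symmetry steps replaced by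
`ge_or_ge_of_union` (MT17 Lemma 3.2 in max form). [cite: MartineauTassion2017, §3.2 Lemma 3.5, Lemma 3.2] -/
theorem exists_equilibriumWQ [Countable V] [G.LocallyFinite] {types : Finset V} (hlip : Lip G φ) (hst : Steps G φ) (hfr : Frames G φ types)
    {p : unitInterval} (hC : CylSubcritical G φ types p) (hp0 : 0 < (p : ℝ)) (hp1 : (p : ℝ) < 1) {M : ℕ} (hM : 1 ≤ M) (SEED : Finset V)
    (ht : t ∈ SEED) (hSM : (↑SEED : Set V) ⊆ cyl φ t M) (hQs : ∀ n, MeetsAS G p (strip φ t n)ᶜ)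
    (hQx : ∀ σu : ℤˣ, MeetsAS G p (Xinf φ t (σu : ℤ) (M + 3))ᶜ) {ε ε₀ : ℝ} (hε0 : 0 < ε) (hε1 : ε < 1)
    (hseed : 1 - ε ^ 32 ≤ (bondPercolation G p).real (TwoAxis.SeedPerc (↑SEED : Set V))) (R : ℕ → ℕ) (hR1 : ∀ L, M ≤ L → 1 ≤ R L)
    (hSR : ∀ L, M ≤ L → (↑SEED : Set V) ⊆ cylBall G φ t L (R L))
    (hRt : ∀ L, M ≤ L → (bondPercolation G p).real (⋃ b ∈ SEED, cylReach G φ t L (R L - 1) b) ≤ ε₀) :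
    ∃ n₁, ∀ n, n₁ ≤ n → EquilibriumAtWQ G φ p t SEED M R (ε + ε₀) n := by
  set μ := bondPercolation G p with hμ
  set M' := M + 3 with hM'
  have hSM' : (↑SEED : Set V) ⊆ cyl φ t M' := hSM.trans (cyl_mono φ t (by omega))
  obtain ⟨nP, hnP⟩ := fact1 (t := t) hlip hst hp0 hp1 (1 : ℤˣ) (M := M') (by omega) SEED ht hSM' (hQx 1)
  obtain ⟨nN, hnN⟩ := fact1 (t := t) hlip hst hp0 hp1 (-1 : ℤˣ) (M := M') (by omega) SEED ht hSM' (hQx (-1))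
  refine ⟨max (max nP nN) (M' + 1), fun n hn => ?_⟩
  have hnP' : nP ≤ n := le_trans (le_trans (le_max_left _ _) (le_max_left _ _)) hn
  have hnN' : nN ≤ n := le_trans (le_trans (le_max_right _ _) (le_max_left _ _)) hn
  have hM'n : M' + 1 ≤ n := le_trans (le_max_right _ _) hn
  have hn1 : 1 ≤ n := by omega
  have hε0' : 0 ≤ ε := hε0.le
  -- seed inside every `C(n,h,ℓ)` with `ℓ ≥ ℓ_B(n,h,M')`
  have hSC : ∀ (h : ℤ) (ℓ : ℕ), ℓB n h M' ≤ ℓ → (↑SEED : Set V) ⊆ pgramCyl φ t n h ℓ := fun h ℓ hℓ =>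
    (hSM'.trans (cyl_subset_pgramCyl_ℓB (by omega) hn1 h)).trans (pgramCyl_mono t n h hℓ)
  -- (12) at every admissible `(h, ℓ)`
  have h12 : ∀ (h : ℤ) (ℓ : ℕ), ℓB n h M' ≤ ℓ → 1 - (ε ^ 16) ^ 2 ≤ μ.real (evLR φ t ↑SEED n h ℓ ∪ evUD φ t ↑SEED n h ℓ) := by
    intro h ℓ hℓ
    have := real_seedPerc_le_evLR_union_evUD (t := t) hlip hfr hC hn1 SEED (hSC h ℓ hℓ)
    have e : (ε ^ 16) ^ 2 = ε ^ 32 := by ring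
    rw [e]; exact hseed.trans this
  -- Fact 1: `Good` at `ℓ_B`; Fact 2: `¬ Good` eventually
  have hgoodB : ∀ h : ℤ, Good G φ t p ↑SEED n h (ℓB n h M') := by
    intro h
    rcases le_or_gt 0 h with hh | hh
    · exact (hnP n hnP' h (by rw [Units.val_one, one_mul, abs_of_nonneg hh])).le
    · exact (hnN n hnN' h (by rw [Units.val_neg, Units.val_one, neg_one_mul, abs_of_neg hh])).le
  have hL : ∀ h : ℤ, ∃ L, ℓB n h M' ≤ L ∧ ∀ ℓ, L < ℓ → ¬ Good G φ t p ↑SEED n h ℓ := by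
    intro h
    obtain ⟨ℓ₁, hℓ₁⟩ := fact2 (t := t) hlip hst hp0 hp1 hn1 h SEED ht (hSC h _ le_rfl) (hQs n)
    refine ⟨max ℓ₁ (ℓB n h M'), le_max_right _ _, fun ℓ hℓ hg => ?_⟩
    have := hℓ₁ ℓ (le_of_lt (lt_of_le_of_lt (le_max_left _ _) hℓ))
    unfold Good at hg
    linarith
  choose L hLB hLnot using hL
  -- the equilibrium height as a function of the shear
  set leq : ℤ → ℕ := fun h => ℓeq G φ t p ↑SEED n h (ℓB n h M') (L h) with hleq
  have hleq_spec : ∀ h, ℓB n h M' ≤ leq h ∧ Good G φ t p ↑SEED n h (leq h) := fun h =>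
    ⟨(ℓeq_spec p (hLB h) (hgoodB h)).1, (ℓeq_spec p (hLB h) (hgoodB h)).2.2⟩
  have hleq_not : ∀ h ℓ, leq h < ℓ → ¬ Good G φ t p ↑SEED n h ℓ := by
    intro h ℓ hℓ
    rcases le_or_gt ℓ (L h) with h1 | h1
    · exact not_good_of_ℓeq_lt p (hLB h) (hgoodB h) hℓ h1
    · exact hLnot h ℓ h1
  have hleq_max : ∀ h ℓ, ℓB n h M' ≤ ℓ → Good G φ t p ↑SEED n h ℓ → ℓ ≤ leq h := by
    intro h ℓ _ hg; by_contra hlt; exact hleq_not h ℓ (not_le.1 hlt) hg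
  -- the optimal shear (a finite window suffices)
  set H : ℕ := n * (leq 0 + 1) with hH
  obtain ⟨h₀, hh₀W, hmin⟩ := Finset.exists_min_image (Finset.Icc (-(H : ℤ)) H) leq ⟨0, by simp⟩
  have hopt : ∀ h : ℤ, leq h₀ ≤ leq h := by
    intro h
    by_cases hw : h ∈ Finset.Icc (-(H : ℤ)) H
    · exact hmin h hw
    · rw [Finset.mem_Icc, not_and_or, not_le, not_le] at hw
      have habs : H < h.natAbs := by rcases hw with hw | hw <;> omega
      have h1 := le_mul_ℓB_succ hn1 h M'
      have h2 : n * (leq 0 + 1) < n * (ℓB n h M' + 1) := by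
        calc n * (leq 0 + 1) = H := rfl
          _ < h.natAbs := habs
          _ ≤ (M' + 1) * (n + h.natAbs) := by nlinarith
          _ ≤ _ := h1
      have h3 : leq 0 < ℓB n h M' := by have := Nat.lt_of_mul_lt_mul_left h2; omega
      exact ((hmin 0 (by simp)).trans h3.le).trans (hleq_spec h).1
  -- `ℓ₀ := ℓ_eq(h₀) + 1`: the sides are likely (19)
  set ℓ₀ : ℕ := leq h₀ + 1 with hℓ₀
  have hℓ₀B : ℓB n h₀ M' ≤ ℓ₀ := (hleq_spec h₀).1.trans (Nat.le_succ _)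
  have hℓ₀5 : 5 ≤ ℓ₀ := by have h1 := le_ℓB hn1 h₀ M'; have h2 := (hleq_spec h₀).1; have h3 : M' = M + 3 := hM'; omega
  have hLR : 1 - ε ^ 16 ≤ μ.real (evLR φ t ↑SEED n h₀ ℓ₀) := by
    have := real_evLR_ge_of_not_good p (hleq_not h₀ ℓ₀ (Nat.lt_succ_self _)) (h12 h₀ ℓ₀ hℓ₀B)
    rwa [sqrt_sq_pow hε0' 16] at this
  -- NO SYMMETRY (MT17 (21) in max form): ONE of the two full sides carries `1 − ε⁸`
  set Tp : Set V := sideSeg φ t n h₀ ℓ₀ 1 (h₀ - ℓ₀) (h₀ + ℓ₀) with hTp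
  set Tm : Set V := sideSeg φ t n h₀ ℓ₀ (-1) (h₀ - ℓ₀) (h₀ + ℓ₀) with hTm
  have hLRT : evLR φ t ↑SEED n h₀ ℓ₀ = evPiece φ t ↑SEED n h₀ ℓ₀ Tp ∪ evPiece φ t ↑SEED n h₀ ℓ₀ Tm := by
    rw [← evPiece_union, hTp, hTm, sideSeg_full_eq φ t hn1 h₀ ℓ₀ (Or.inl rfl), sideSeg_full_eq φ t hn1 h₀ ℓ₀ (Or.inr rfl), evLR,
      LRset_eq_union]; rfl
  obtain ⟨σ₀, hσ₀, hside⟩ : ∃ σ₀ : ℤ, (σ₀ = 1 ∨ σ₀ = -1) ∧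
      1 - ε ^ 8 ≤ μ.real (evPiece φ t ↑SEED n h₀ ℓ₀ (sideSeg φ t n h₀ ℓ₀ σ₀ (h₀ - ℓ₀) (h₀ + ℓ₀))) := by
    have e : ε ^ 16 = (ε ^ 8) ^ 2 := by ring
    rw [hLRT, e] at hLR
    rcases ge_or_ge_of_union p (isUpperSet_evPiece φ t _ n h₀ ℓ₀ _) (isUpperSet_evPiece φ t _ n h₀ ℓ₀ _)
      (IsoradialArmExtension.measurableSet_openCrossing' _ _ _) (IsoradialArmExtension.measurableSet_openCrossing' _ _ _) hLR with h1 | h1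
    · rw [sqrt_sq_pow hε0' 8] at h1; exact ⟨1, Or.inl rfl, h1⟩
    · rw [sqrt_sq_pow hε0' 8] at h1; exact ⟨-1, Or.inr rfl, h1⟩
  set T : Set V := sideSeg φ t n h₀ ℓ₀ σ₀ (h₀ - ℓ₀) (h₀ + ℓ₀) with hT
  -- thirds (20): a sub-segment `[x, y] ⊆ [h₀ − ℓ₀, h₀ + ℓ₀]` of length `≤ d` carries `1 − ε²`
  set d : ℕ := (2 * ℓ₀ + 2) / 3 with hd
  have hd3 : 2 * ℓ₀ ≤ 3 * d + 0 := by omega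
  have hthird : ∃ x y : ℤ, h₀ - ℓ₀ ≤ x ∧ x ≤ y ∧ y ≤ h₀ + ℓ₀ ∧ y - x ≤ d ∧
      1 - ε ^ 2 ≤ μ.real (evPiece φ t ↑SEED n h₀ ℓ₀ (sideSeg φ t n h₀ ℓ₀ σ₀ x y)) := by
    set T1 := sideSeg φ t n h₀ ℓ₀ σ₀ (h₀ - ℓ₀) (h₀ - ℓ₀ + d) with hT1
    set T2 := sideSeg φ t n h₀ ℓ₀ σ₀ (h₀ - ℓ₀ + d) (h₀ + ℓ₀ - d) with hT2
    set T3 := sideSeg φ t n h₀ ℓ₀ σ₀ (h₀ + ℓ₀ - d) (h₀ + ℓ₀) with hT3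
    have hcov : T ⊆ T1 ∪ (T2 ∪ T3) := by
      intro w hw
      rw [hT, mem_sideSeg] at hw
      obtain ⟨hC', hα, hlo, hhi⟩ := hw
      simp only [hT1, hT2, hT3, Set.mem_union, mem_sideSeg]
      rcases le_or_gt (σ₀ * relCoord φ t 1 w) (h₀ - ℓ₀ + d) with h1 | h1
      · exact Or.inl ⟨hC', hα, hlo, h1⟩
      · rcases le_or_gt (σ₀ * relCoord φ t 1 w) (h₀ + ℓ₀ - d) with h2 | h2
        · exact Or.inr (Or.inl ⟨hC', hα, h1.le, h2⟩)
        · exact Or.inr (Or.inr ⟨hC', hα, h2.le, hhi⟩)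
    have hU : 1 - (ε ^ 4) ^ 2 ≤ μ.real (evPiece φ t ↑SEED n h₀ ℓ₀ T1 ∪ evPiece φ t ↑SEED n h₀ ℓ₀ (T2 ∪ T3)) := by
      rw [← evPiece_union]
      have e : (ε ^ 4) ^ 2 = ε ^ 8 := by ring
      rw [e]; exact hside.trans (measureReal_mono (evPiece_mono φ t ↑SEED n h₀ ℓ₀ hcov))
    rcases ge_or_ge_of_union p (isUpperSet_evPiece φ t _ n h₀ ℓ₀ _) (isUpperSet_evPiece φ t _ n h₀ ℓ₀ _)
      (IsoradialArmExtension.measurableSet_openCrossing' _ _ _) (IsoradialArmExtension.measurableSet_openCrossing' _ _ _) hU with h1 | h1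
    · rw [sqrt_sq_pow hε0' 4] at h1
      have hε4 : ε ^ 4 ≤ ε ^ 2 := pow_le_pow_of_le_one hε0' hε1.le (by norm_num)
      exact ⟨h₀ - ℓ₀, h₀ - ℓ₀ + d, le_rfl, by omega, by omega, by omega, by linarith⟩
    · rw [sqrt_sq_pow hε0' 4, evPiece_union] at h1
      have e : ε ^ 4 = (ε ^ 2) ^ 2 := by ring
      rw [e] at h1
      rcases ge_or_ge_of_union p (isUpperSet_evPiece φ t _ n h₀ ℓ₀ _) (isUpperSet_evPiece φ t _ n h₀ ℓ₀ _)
        (IsoradialArmExtension.measurableSet_openCrossing' _ _ _) (IsoradialArmExtension.measurableSet_openCrossing' _ _ _) h1 with h2 | h2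
      · rw [sqrt_sq_pow hε0' 2] at h2
        exact ⟨h₀ - ℓ₀ + d, h₀ + ℓ₀ - d, by omega, by omega, by omega, by omega, h2⟩
      · rw [sqrt_sq_pow hε0' 2] at h2
        exact ⟨h₀ + ℓ₀ - d, h₀ + ℓ₀, by omega, by omega, le_rfl, by omega, h2⟩
  obtain ⟨x, y, hx, hxy, hy, hyx, hxyP⟩ := hthird
  have e2 : ε ^ 2 = (ε ^ 1) ^ 2 := by ring
  rw [e2] at hxyP
  obtain ⟨u, hxu, huy, hPdown, hPup⟩ := exists_split_side φ t p (↑SEED) n h₀ ℓ₀ σ₀ hxy (by positivity)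
    (by rw [← e2]; exact pow_lt_one₀ hε0' hε1 (by norm_num)) hxyP
  rw [sqrt_sq_pow hε0' 1, pow_one] at hPdown hPup
  set ℓ : ℕ := leq u with hℓdef
  have hℓB : ℓB n u M' ≤ ℓ := (hleq_spec u).1
  have hℓ₀ℓ : ℓ₀ ≤ ℓ + 1 := by have := hopt u; omega
  have hdℓ : (d : ℤ) ≤ ℓ := by have h1 : d ≤ ℓ := by omega
                               exact_mod_cast h1
  have h23 : 2 * ℓ₀ ≤ 3 * ℓ := by omega
  have huh₀ : |u - h₀| ≤ ℓ₀ := abs_le.2 ⟨by omega, by omega⟩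
  have hCC : pgramCyl φ t n h₀ ℓ₀ ⊆ pgramCyl φ t n u (3 * ℓ) := pgramCyl_subset_recentre huh₀ h23
  have hmulB := le_mul_ℓB_succ hn1 u M'
  have hmul : (M + 4) * (n + u.natAbs) ≤ n * (ℓ + 1) := by
    calc (M + 4) * (n + u.natAbs) = (M' + 1) * (n + u.natAbs) := by rw [hM']
      _ ≤ n * (ℓB n u M' + 1) := hmulB
      _ ≤ n * (ℓ + 1) := Nat.mul_le_mul_left _ (by omega)
  -- the top layer: Good at `ℓ_eq(u)` (17); NO SYMMETRY (MT17 (26) in max form): ONE of top/bottom carries `1 − ε⁸`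
  have hUD : 1 - ε ^ 16 ≤ μ.real (evUD φ t ↑SEED n u ℓ) := by
    have := real_evUD_ge_of_good p (hleq_spec u).2 (h12 u ℓ hℓB)
    rwa [sqrt_sq_pow hε0' 16] at this
  have hUDT : evUD φ t ↑SEED n u ℓ =
      evPiece φ t ↑SEED n u ℓ (topSeg φ t n u ℓ 1 (-(n : ℤ)) n) ∪ evPiece φ t ↑SEED n u ℓ (topSeg φ t n u ℓ (-1) (-(n : ℤ)) n) := by
    rw [← evPiece_union, evUD, UDset_eq_union]; rfl
  obtain ⟨σ₁, hσ₁, htop⟩ : ∃ σ₁ : ℤ, (σ₁ = 1 ∨ σ₁ = -1) ∧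
      1 - (ε ^ 4) ^ 2 ≤ μ.real (evPiece φ t ↑SEED n u ℓ (topSeg φ t n u ℓ σ₁ (-(n : ℤ)) n)) := by
    have e : ε ^ 16 = (ε ^ 8) ^ 2 := by ring
    have e' : ε ^ 8 = (ε ^ 4) ^ 2 := by ring
    rw [hUDT, e] at hUD
    rcases ge_or_ge_of_union p (isUpperSet_evPiece φ t _ n u ℓ _) (isUpperSet_evPiece φ t _ n u ℓ _)
      (IsoradialArmExtension.measurableSet_openCrossing' _ _ _) (IsoradialArmExtension.measurableSet_openCrossing' _ _ _) hUD with h1 | h1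
    · rw [sqrt_sq_pow hε0' 8, e'] at h1; exact ⟨1, Or.inl rfl, h1⟩
    · rw [sqrt_sq_pow hε0' 8, e'] at h1; exact ⟨-1, Or.inr rfl, h1⟩
  obtain ⟨v, hvlo, hvhi, hPleft, hPright⟩ := exists_split_top φ t p (↑SEED) n u ℓ σ₁ (x := -(n : ℤ)) (y := n) (by omega) (by positivity)
    (pow_lt_one₀ (by positivity) (pow_lt_one₀ hε0' hε1 (by norm_num)) (by norm_num)) htop
  rw [sqrt_sq_pow hε0' 4] at hPleft hPright
  have hε4 : ε ^ 4 ≤ ε := by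
    calc ε ^ 4 ≤ ε ^ 1 := pow_le_pow_of_le_one hε0' hε1.le (by norm_num)
      _ = ε := pow_one ε
  set L3 : ℕ := pgScale n u (3 * ℓ) with hL3
  have hML3 : M ≤ L3 := by have : n ≤ L3 := le_max_left _ _; omega
  set R₀ : ℕ := R L3 - 1 with hR₀
  have hRL3 : R L3 = R₀ + 1 := by have := hR1 L3 hML3; omega
  have hBall : (↑SEED : Set V) ⊆ cylBall G φ t (pgScale n u (3 * ℓ)) (R₀ + 1) := by rw [← hRL3]; exact hSR L3 hML3
  have htail : μ.real (⋃ b ∈ SEED, cylReach G φ t (pgScale n u (3 * ℓ)) R₀ b) ≤ ε₀ := hRt L3 hML3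
  -- the two halves of the preferred vertical side
  have hup : 1 - (ε + ε₀) ≤ μ.real (linkIn (pgramPrism G φ t n u (3 * ℓ) (R L3)) SEED (pgSideHalfW G φ t n u ℓ (R L3) σ₀ σ₀)) := by
    rw [hRL3]
    have := real_evPiece_le_linkIn_add (t := t) p hn1 u ℓ R₀ hCC SEED hBall (T := sideSeg φ t n h₀ ℓ₀ σ₀ u y)
      (F := pgSideHalfW G φ t n u ℓ (R₀ + 1) σ₀ σ₀)
      (fun y' hy' hT' => (mem_pgSideHalfW G φ).2 ⟨hy', sideSeg_subset_half_up' hσ₀ (by omega) hT'⟩)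
    have hP : 1 - ε ≤ μ.real (openCrossing (pgramCyl φ t n h₀ ℓ₀) ↑SEED (sideSeg φ t n h₀ ℓ₀ σ₀ u y)) := hPup
    linarith
  have hdown : 1 - (ε + ε₀) ≤ μ.real (linkIn (pgramPrism G φ t n u (3 * ℓ) (R L3)) SEED (pgSideHalfW G φ t n u ℓ (R L3) σ₀ (-σ₀))) := by
    rw [hRL3]
    have := real_evPiece_le_linkIn_add (t := t) p hn1 u ℓ R₀ hCC SEED hBall (T := sideSeg φ t n h₀ ℓ₀ σ₀ x u)
      (F := pgSideHalfW G φ t n u ℓ (R₀ + 1) σ₀ (-σ₀))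
      (fun y' hy' hT' => (mem_pgSideHalfW G φ).2 ⟨hy', sideSeg_subset_half_down' hσ₀ (by omega) hT'⟩)
    have hP : 1 - ε ≤ μ.real (openCrossing (pgramCyl φ t n h₀ ℓ₀) ↑SEED (sideSeg φ t n h₀ ℓ₀ σ₀ x u)) := hPdown
    linarith
  have hsideP : ∀ τ : ℤ, (τ = 1 ∨ τ = -1) →
      1 - (ε + ε₀) ≤ μ.real (linkIn (pgramPrism G φ t n u (3 * ℓ) (R L3)) SEED (pgSideHalfW G φ t n u ℓ (R L3) σ₀ τ)) := by
    intro τ hτ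
    rcases hσ₀ with rfl | rfl <;> rcases hτ with rfl | rfl
    · exact hup
    · exact hdown
    · simpa using hdown
    · exact hup
  -- the two pieces of the preferred slanted side
  have htopP : ∀ τ : ℤ, (τ = 1 ∨ τ = -1) →
      1 - (ε + ε₀) ≤ μ.real (linkIn (pgramPrism G φ t n u (3 * ℓ) (R L3)) SEED (pgTopPieceW G φ t n u ℓ (R L3) σ₁ τ v)) := by
    intro τ hτ
    rw [hRL3]
    have hCu : pgramCyl φ t n u ℓ ⊆ pgramCyl φ t n u (3 * ℓ) := pgramCyl_mono t n u (by omega)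
    rcases hτ with rfl | rfl
    · have := real_evPiece_le_linkIn_add (t := t) p hn1 u ℓ R₀ hCu SEED hBall (T := topSeg φ t n u ℓ σ₁ v n)
        (F := pgTopPieceW G φ t n u ℓ (R₀ + 1) σ₁ 1 v)
        (fun y' hy' hT' => (mem_pgTopPieceW G φ).2 ⟨hy', topSeg_subset_piece' (Or.inl ⟨rfl, rfl, rfl⟩) hT'⟩)
      have hP : 1 - ε ^ 4 ≤ μ.real (openCrossing (pgramCyl φ t n u ℓ) ↑SEED (topSeg φ t n u ℓ σ₁ v n)) := hPright
      linarith
    · have := real_evPiece_le_linkIn_add (t := t) p hn1 u ℓ R₀ hCu SEED hBall (T := topSeg φ t n u ℓ σ₁ (-(n : ℤ)) v)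
        (F := pgTopPieceW G φ t n u ℓ (R₀ + 1) σ₁ (-1) v)
        (fun y' hy' hT' => (mem_pgTopPieceW G φ).2 ⟨hy', topSeg_subset_piece' (Or.inr ⟨rfl, rfl, rfl⟩) hT'⟩)
      have hP : 1 - ε ^ 4 ≤ μ.real (openCrossing (pgramCyl φ t n u ℓ) ↑SEED (topSeg φ t n u ℓ σ₁ (-(n : ℤ)) v)) := hPleft
      linarith
  refine ⟨σ₀, σ₁, u, ℓ, v, hσ₀, hσ₁, by omega, ?_, abs_le.2 ⟨hvlo, hvhi⟩, ?_, fun σ τ hσ _ =>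
    ⟨disjoint_pgSideHalfW_cyl t (by omega) u ℓ _ hσ τ, disjoint_pgTopPieceW_cyl t hn1 hmul _ hσ τ v⟩, fun τ hτ => ⟨hsideP τ hτ, htopP τ hτ⟩⟩
  · have := le_ℓB hn1 u M'; omega
  · have : (M + 1) * (n + u.natAbs) ≤ n * (ℓ + 1) := le_trans (Nat.mul_le_mul_right _ (by omega)) hmul
    exact_mod_cast this

end Eq

end Skelφ

end Summit.CriticalPhenomena.PercolationContinuityZ3.Theorems.Transplant

end
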